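import Summits.QuantumFields.YangMills.Theorems.UnitScaleTiltProp7MassivePropagatorAgmonLetters
import Mathlib.Analysis.InnerProductSpace.ProdL2
import HarnessLib

/-!
# Route `UnitScaleTilt`, crux «MinimiserStabilityRegPr» (stmt-QuantumFields-19200, stub EX), positivity block, the LOD ∕ Combes–Thomas line (★p1 g24 `LOCATE-P349-CT` v2 §7 (E2);
# ★★OWNER RULING №35 «(L3′a) GO in R3»; chair 22:12:46Z «px5 g11 ← (L3′a) MEMBER FILE», pins 22:17:29Z (2) «export (A-L²) AND (A-H¹)») — **(L3′a) FILE B «THE MASSIVE OPERATOR»: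
# `A = Δ_{U₀} + a·T(ι(Q″·))` IS COERCIVE WITH THE (L2′-GAP) CONSTANT, HENCE INVERTIBLE (`G_a` exists, `‖G_a‖ ≤ C_P²`), and the conjugation defects of `D_{U₀} ⊕ √a·ι∘Q″` by a
# positive weight are IDENTIFIED** (gradient: the relative defect of FILE A; mass: `ι(Q″(((w_c∘B)⁻¹w − 1)·λ))` since `Q″` commutes with block constants) — the inputs of FILE C
# `…Prop7MassivePropagatorAgmon`, which applies the namer's ✓`Prop7CorrectorAgmonDecay.agmon_corrector_bound` at `Pt := id` (ym3-torus-px5 g11, `LOCATE-L3a-px5g11.md`).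

Cell `ym3-torus` (HUMAN RULING D-0037: YM₃ on T³ is ladder rung R3 — NOT d = 4, NOT infinite volume, NOT a mass gap, NOT Clay).  Width seat `ym3-torus-px5` (gen 11; WIDTH COPY of
ym3-torus-p1).  THEOREMS ONLY (0 `def`, 0 `sorry`); `--supports stmt-QuantumFields-19200 --as helper`, count-neutral.  HONEST LABEL (№35 (6)): «(L3′a) = [Balaban1985BackgroundPropagators]
(3.46)-class weighted-L² Agmon row by a Combes–Thomas ∕ Agmon argument at the T³ member; (3.42) pointwise (L3′b) NOT claimed; feeds `hGF`[Lift] via (L5′)∕(L4); does NOT feed `h349`[Lift] alone».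

THE OBJECTS (all hypothesis-form, no definition).  `E := SiteL2K ℂ 3 (periodsT3 F K) c₀ W₂`; `Q''` ANY linear map with clauses (iii)+(iv) of ✓`exists_intertwiner_of_regPr` (the `hseq` of
✓p746531 VERBATIM); `ι` THE BLOCK-CONSTANT LIFT `c ↦ toL2S F n c₁ (c ∘ siteShift)` into `SiteL2K ℂ 3 (periodsT3 F n) c₁ W₂` (`hι`); `T` any adjoint of `ι∘Q″` (`hT : ⟪ι(Q″λ), f⟫ = ⟪λ, Tf⟫`,
✓p747466 `inner_adjoint_comp` supplies one); the MASSIVE OPERATOR `A λ := covLapSite U₀ λ + a·T(ι(Q″λ))` (print's `Δ′_a = Δ^η_U + Q′*aQ′`, (3.24)); its gap `re⟪λ, Aλ⟫ = ‖D_{U₀}λ‖² +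
a‖ι(Q″λ)‖² ≥ C_P⁻²‖λ‖²` is (L2′-GAP) ✓p747976 read through `hι`.  THE ENGINE: ✓`agmon_corrector_bound` with `D := D̃ = D_{U₀} ⊕ √a·ι∘Q″ : E → WithLp 2 (BondL2K × SiteL2K_n)`,
`Pt := id` (no constraint: `K₂ = K₂′ = 0`), weights `M = w·` on sites, `M′ = w(b₋)· ⊕ (w_c∘B)·` on bonds ⊕ coarse sites, defects `K₁ = (η⁻¹(w₊∕w₋ − 1)·Ad(U₀)λ(·₊)) ⊕
(√a·ι(Q″((w∕(w_c∘B) − 1)·λ)))` (FILE A §4 + §2: `Q″` commutes with the block-constant `w_c∘B`), `‖K₁‖ ≤ δ₁` by FILE A `normSq_gradDefect_le` + `normSq_lift_topMean_le`.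

WHAT IS PROVED (sorry-free, no definition; ns `…Theorems.Prop7MassivePropagatorCoercive`).
* §1 `re_inner_massive_eq` (`re⟪λ, Aλ⟫ = ‖DL2 λ‖² + a‖ι(Q''λ)‖²`); ★★`coercive_massive` — `‖λ‖² ≤ C_P²·(‖DL2 U₀ λ‖² + a·‖ι(Q''λ)‖²)`, `C_P² := max 2 (16c₀(L^{K−n})³∕(a·c₁))`
  (✓p747976 `…_frob` + `hι` + ✓`normSq_toL2S_comp_siteShift_eq`); ★`massive_injective` ∕ ★★`exists_unique_massive_solution` (`G_a` exists: `∀ f, ∃! u, A u = f`) ∕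
  ★`norm_le_of_massive_eq` (`‖u‖ ≤ C_P²‖f‖`).
* §2 `exists_siteMul` ∕ `exists_bondMul` (real multipliers as `ℂ`-linear endomorphisms of `SiteL2K` ∕ `BondL2K`, existence form — no definition).
* §2b `bondMulInv_DL2_siteMul_sub` (the gradient defect `Nbi(D(w·λ)) − Dλ = toL2(η⁻¹(w₊∕w₋ − 1)·Ad(U₀)λ(·₊))`), `siteMulInv_lift_topMean_siteMul_sub` (the mass defect
  `Nci(ι(Q″(w·λ))) − ι(Q″λ) = ι(Q″(((wci∘B)·w − 1)·λ))`).
HONEST SCOPE.  Coercivity ∕ existence ∕ defect identities only — the Agmon rows are FILE C; (3.42) pointwise (L3′b), the Gram∕`M⁻¹`∕`P` assembly (L5′), IMS (L4), local gauge (L5), and `hGF`∕`h349`∕EX are NOT here; nothing continuum ∕ OS ∕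
mass-gap ∕ Clay.

References: T. Bałaban, CMP **99** (1985) 389–434 [Balaban1985BackgroundPropagators] (Thm 3.1 (3.46) p.398, (3.24)–(3.25) p.394, Thm 3.11 p.416); CMP **89** (1983) 571–597
[Balaban1983RegularityDecay] ((1.8) p.573); S. Agmon, *Lectures on exponential decay of solutions of second-order elliptic equations* (Princeton 1982) Ch. 1 [Agmon1982]; A. Målqvist,
D. Peterseim, Math. Comp. **83** (2014) 2583–2603 (LOD corrector decay — the engine's shape).
-/

set_option autoImplicit false

noncomputable section

open scoped BigOperators Matrix.Norms.L2Operator InnerProductSpace ComplexConjugate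

namespace Summit.QuantumFields.YangMills.Theorems.Prop7MassivePropagatorCoercive

open Literature.MathematicalPhysics.QuantumFieldTheory.Balaban1983to89
open Finset
open T4Continuum BlockAveraging
open BlockAveraging (Idx)
open B7Prop1Explicit (U1 disp)
open B5Eq118OneStroke (iterBlockOf iterBlock)
open B10Eq27TorusAxialLog (holT transl)
open B7TransferAnalyticMean (meanCLM)
open B9Eq311L2Pairing (WL2)
open B11Eq103H1Complex (SiteL2K BondL2K)
open B9Eq39Adjoint (R)
open Summit.QuantumFields.YangMills.Theorems.Prop8Chart (emlIterU)
open Literature.MathematicalPhysics.QuantumFieldTheory.Balaban1983to89.T3ContinuumYM3Torus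
open T3SectALandauChart (eta eta_pos bgUnits)
open T3PrintedRegularMinimiser (RegPr)
open T3PrintedRegularOrbits (sites_eq)
open T3LevelShift (siteShift)
open Summit.QuantumFields.YangMills.Theorems.Prop7SectET3Transport (periodsT3)
open Summit.QuantumFields.YangMills.Theorems.Prop7SectET3HilbertLetters (W₂ toL2 toL2S DL2 DstarL2 covLapSite adjoint_DL2 inner_toL2)
open Summit.QuantumFields.YangMills.Theorems.Prop7SectET3RealCoordSums (inner_toL2S)
open Summit.QuantumFields.YangMills.Theorems.Prop7BlockBumpExtension (normSq_toL2S_comp_siteShift_eq)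
open Summit.QuantumFields.YangMills.Theorems.Prop7BlockPoincareTopMeanKept (normSq_le_two_mul_normSq_DL2_add_topMean_frob)
open Summit.QuantumFields.YangMills.Theorems.Prop7MassivePropagatorAgmonLetters

variable (F : T3Family) {n K : ℕ} (h : n ≤ K) {c₀ c₁ : ℝ} [Fact (0 < c₀)] [Fact (0 < c₁)]
  {ε₀ : ℝ} (hε₀ : 0 < ε₀) (hε7 : 10 ^ 7 * (F.L : ℝ) ^ 3 * ε₀ ≤ 1)
  (U₀ : GaugeField (F.P K) 0 (Matrix.specialUnitaryGroup (Fin 2) ℂ)) (hreg : RegPr F n K ε₀ U₀)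
  (Q'' : SiteL2K ℂ 3 (periodsT3 F K) c₀ W₂ →ₗ[ℂ] (Site (F.P K) (K - n) → Matrix (Fin 2) (Fin 2) ℂ))
  (hseq : ∀ lam : Site (F.P K) 0 → Matrix (Fin 2) (Fin 2) ℂ, ∃ ns : (j : ℕ) → Site (F.P K) j → Matrix (Fin 2) (Fin 2) ℂ, ns 0 = lam ∧
      (∀ (j : ℕ) (y : Site (F.P K) (j + 1)), ns (j + 1) y = ns j (emb y) - meanCLM (Idx (F.P K)) (Matrix (Fin 2) (Fin 2) ℂ) fun i : Idx (F.P K) =>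
        ns j (emb y) - ((holT (emlIterU j (bgUnits F K U₀)) (emb y) (stairWord i.2.1 (off i.1)) : (Matrix (Fin 2) (Fin 2) ℂ)ˣ) : Matrix (Fin 2) (Fin 2) ℂ) *
          ns j (transl (emb y) (disp (stairWord i.2.1 (off i.1)))) * (((holT (emlIterU j (bgUnits F K U₀)) (emb y) (stairWord i.2.1 (off i.1)))⁻¹ : (Matrix (Fin 2) (Fin 2) ℂ)ˣ) : Matrix (Fin 2) (Fin 2) ℂ)) ∧
      ns (K - n) = Q'' (toL2S F K c₀ lam))
  (ι : (Site (F.P K) (K - n) → Matrix (Fin 2) (Fin 2) ℂ) →ₗ[ℂ] SiteL2K ℂ 3 (periodsT3 F n) c₁ W₂)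
  (hι : ∀ c, ι c = toL2S F n c₁ (fun z => c (siteShift (sites_eq F n K h) z)))
  (T : SiteL2K ℂ 3 (periodsT3 F n) c₁ W₂ →ₗ[ℂ] SiteL2K ℂ 3 (periodsT3 F K) c₀ W₂)
  (hT : ∀ (l : SiteL2K ℂ 3 (periodsT3 F K) c₀ W₂) (f : SiteL2K ℂ 3 (periodsT3 F n) c₁ W₂), ⟪ι (Q'' l), f⟫_ℂ = ⟪l, T f⟫_ℂ)
  {a : ℝ} (ha : 0 < a)

/-! ## §1 The massive operator `A = Δ_{U₀} + a·Q″†Q″`: coercivity from (L2′-GAP), invertibility -/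

include hT in
/-- **THE FORM OF THE MASSIVE OPERATOR**: `re⟪λ, Δ_{U₀}λ + a·T(ι(Q″λ))⟫ = ‖D_{U₀}λ‖² + a·‖ι(Q″λ)‖²` (✓`inner_covLapSite`, `hT`). [cite: Balaban1985BackgroundPropagators, (3.24) p.394, (3.16) p.393] -/
theorem re_inner_massive_eq (l : SiteL2K ℂ 3 (periodsT3 F K) c₀ W₂) :
    RCLike.re ⟪l, covLapSite F n K c₀ U₀ l + (a : ℂ) • T (ι (Q'' l))⟫_ℂ = ‖DL2 F n K c₀ U₀ l‖ ^ 2 + a * ‖ι (Q'' l)‖ ^ 2 := by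
  rw [inner_add_right, inner_smul_right, ← hT, map_add, RCLike.re_to_complex, RCLike.re_to_complex,
    Summit.QuantumFields.YangMills.Theorems.Prop7SectET3HilbertLetters.inner_covLapSite, inner_self_eq_norm_sq_to_K]
  simp only [Complex.mul_re, Complex.ofReal_re, Complex.ofReal_im, zero_mul, sub_zero]
  norm_cast

include hε₀ hε7 hreg hseq hι ha in
/-- ★★ **COERCIVITY OF THE MASSIVE OPERATOR FROM (L2′-GAP)**: with `C_P² := max 2 (16c₀(L^{K−n})³∕(a·c₁))`, for every `λ ∈ E`,
`‖λ‖² ≤ C_P²·(‖D_{U₀}λ‖² + a·‖ι(Q″λ)‖²) = C_P²·re⟪λ, Aλ⟫` — ✓p747976 `normSq_le_two_mul_normSq_DL2_add_topMean_frob` with its coarse Frobenius sum read as `‖ι(Q″λ)‖²∕c₁`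
(✓`normSq_toL2S_comp_siteShift_eq`).  Print: `Δ′_a ≥ γ₀`. [cite: Balaban1983RegularityDecay, (1.8) p.573; Balaban1985BackgroundPropagators, (3.24) p.394, Thm 3.11 p.416] -/
theorem coercive_massive (l : SiteL2K ℂ 3 (periodsT3 F K) c₀ W₂) :
    ‖l‖ ^ 2 ≤ max 2 (16 * c₀ * ((F.L : ℝ) ^ (K - n)) ^ 3 / (a * c₁)) * (‖DL2 F n K c₀ U₀ l‖ ^ 2 + a * ‖ι (Q'' l)‖ ^ 2) := by
  have hc₁ : 0 < c₁ := Fact.out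
  obtain ⟨lam, rfl⟩ : ∃ lam : Site (F.P K) 0 → Matrix (Fin 2) (Fin 2) ℂ, l = toL2S F K c₀ lam := ⟨(toL2S F K c₀).symm l, ((toL2S F K c₀).apply_symm_apply l).symm⟩
  have hgap := normSq_le_two_mul_normSq_DL2_add_topMean_frob F hε₀ hε7 U₀ hreg Q'' hseq lam
  have hιn : ‖ι (Q'' (toL2S F K c₀ lam))‖ ^ 2 = c₁ * ∑ y : Site (F.P K) (K - n), ∑ j : Fin 2, ∑ k : Fin 2, ‖Q'' (toL2S F K c₀ lam) y j k‖ ^ 2 := by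
    rw [hι, normSq_toL2S_comp_siteShift_eq F h]
  set S : ℝ := ∑ y : Site (F.P K) (K - n), ∑ j : Fin 2, ∑ k : Fin 2, ‖Q'' (toL2S F K c₀ lam) y j k‖ ^ 2 with hS
  set Dn : ℝ := ‖DL2 F n K c₀ U₀ (toL2S F K c₀ lam)‖ ^ 2 with hDn
  set Mx : ℝ := max 2 (16 * c₀ * ((F.L : ℝ) ^ (K - n)) ^ 3 / (a * c₁)) with hMx
  have hS0 : 0 ≤ S := Finset.sum_nonneg fun _ _ => Finset.sum_nonneg fun _ _ => Finset.sum_nonneg fun _ _ => sq_nonneg _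
  have hD0 : 0 ≤ Dn := sq_nonneg _
  have h2 : (2 : ℝ) ≤ Mx := le_max_left _ _
  have h16 : 16 * c₀ * ((F.L : ℝ) ^ (K - n)) ^ 3 ≤ Mx * (a * c₁) := by
    have := le_max_right 2 (16 * c₀ * ((F.L : ℝ) ^ (K - n)) ^ 3 / (a * c₁))
    rwa [← hMx, div_le_iff₀ (by positivity)] at this
  rw [hιn]
  calc ‖toL2S F K c₀ lam‖ ^ 2 ≤ 2 * Dn + 16 * c₀ * ((F.L : ℝ) ^ (K - n)) ^ 3 * S := hgap
    _ ≤ Mx * Dn + Mx * (a * c₁) * S := add_le_add (mul_le_mul_of_nonneg_right h2 hD0) (mul_le_mul_of_nonneg_right h16 hS0)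
    _ = Mx * (Dn + a * (c₁ * S)) := by ring

include hε₀ hε7 hreg hseq hι hT ha in
/-- ★ **THE MASSIVE OPERATOR IS INJECTIVE** (coercivity). [cite: Balaban1985BackgroundPropagators, Thm 3.11 p.416] -/
theorem massive_injective :
    Function.Injective fun l : SiteL2K ℂ 3 (periodsT3 F K) c₀ W₂ => covLapSite F n K c₀ U₀ l + (a : ℂ) • T (ι (Q'' l)) := by
  have hlin : ∃ Aop : SiteL2K ℂ 3 (periodsT3 F K) c₀ W₂ →ₗ[ℂ] SiteL2K ℂ 3 (periodsT3 F K) c₀ W₂, ∀ l, Aop l = covLapSite F n K c₀ U₀ l + (a : ℂ) • T (ι (Q'' l)) :=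
    ⟨covLapSite F n K c₀ U₀ + (a : ℂ) • (T ∘ₗ ι ∘ₗ Q''), fun l => rfl⟩
  obtain ⟨Aop, hA⟩ := hlin
  have hker : ∀ l, Aop l = 0 → l = 0 := by
    intro l hl
    have hco := coercive_massive F h hε₀ hε7 U₀ hreg Q'' hseq ι hι ha l
    have hre := re_inner_massive_eq F U₀ Q'' ι T hT (a := a) l
    rw [← hA, hl, inner_zero_right, map_zero] at hre
    have hD : ‖DL2 F n K c₀ U₀ l‖ ^ 2 + a * ‖ι (Q'' l)‖ ^ 2 = 0 := by linarith
    rw [hD, mul_zero] at hco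
    have : ‖l‖ = 0 := by nlinarith [norm_nonneg l]
    exact norm_eq_zero.mp this
  intro l l' hll'
  have h0 : Aop (l - l') = 0 := by rw [map_sub, hA, hA]; exact sub_eq_zero.mpr hll'
  exact sub_eq_zero.mp (hker _ h0)

include hε₀ hε7 hreg hseq hι hT ha in
/-- ★★ **`G_a` EXISTS**: for every `f` there is a unique `u` with `Δ_{U₀}u + a·T(ι(Q″u)) = f` (injective endomorphism of a finite-dimensional space).
[cite: Balaban1985BackgroundPropagators, (3.24)–(3.25) p.394, Thm 3.11 p.416] -/
theorem exists_unique_massive_solution (f : SiteL2K ℂ 3 (periodsT3 F K) c₀ W₂) :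
    ∃! u : SiteL2K ℂ 3 (periodsT3 F K) c₀ W₂, covLapSite F n K c₀ U₀ u + (a : ℂ) • T (ι (Q'' u)) = f := by
  set Aop : SiteL2K ℂ 3 (periodsT3 F K) c₀ W₂ →ₗ[ℂ] SiteL2K ℂ 3 (periodsT3 F K) c₀ W₂ := covLapSite F n K c₀ U₀ + (a : ℂ) • (T ∘ₗ ι ∘ₗ Q'') with hAop
  have hA : ∀ l, Aop l = covLapSite F n K c₀ U₀ l + (a : ℂ) • T (ι (Q'' l)) := fun l => rfl
  have hinj : Function.Injective Aop := by
    have := massive_injective F h hε₀ hε7 U₀ hreg Q'' hseq ι hι T hT ha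
    intro l l' hll'
    exact this (by simp only [← hA]; exact hll')
  have hsurj : Function.Surjective Aop := LinearMap.injective_iff_surjective.mp hinj
  obtain ⟨u, hu⟩ := hsurj f
  refine ⟨u, ?_, fun v hv => ?_⟩
  · show covLapSite F n K c₀ U₀ u + (a : ℂ) • T (ι (Q'' u)) = f
    rw [← hA]; exact hu
  · have hv' : Aop v = f := by rw [hA]; exact hv
    exact hinj (hv'.trans hu.symm)

include hε₀ hε7 hreg hseq hι hT ha in
/-- ★ **`‖G_a f‖ ≤ C_P²‖f‖`** (coercivity + Cauchy–Schwarz). [cite: Balaban1985BackgroundPropagators, Thm 3.11 p.416; Balaban1983RegularityDecay, (1.8) p.573] -/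
theorem norm_le_of_massive_eq (u f : SiteL2K ℂ 3 (periodsT3 F K) c₀ W₂) (hAu : covLapSite F n K c₀ U₀ u + (a : ℂ) • T (ι (Q'' u)) = f) :
    ‖u‖ ≤ max 2 (16 * c₀ * ((F.L : ℝ) ^ (K - n)) ^ 3 / (a * c₁)) * ‖f‖ := by
  have hco := coercive_massive F h hε₀ hε7 U₀ hreg Q'' hseq ι hι ha u
  have hre := re_inner_massive_eq F U₀ Q'' ι T hT (a := a) u
  rw [hAu] at hre
  have hcs : RCLike.re ⟪u, f⟫_ℂ ≤ ‖u‖ * ‖f‖ := (RCLike.re_le_norm _).trans (norm_inner_le_norm _ _)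
  set Mx : ℝ := max 2 (16 * c₀ * ((F.L : ℝ) ^ (K - n)) ^ 3 / (a * c₁)) with hMx
  have hMx0 : 0 ≤ Mx := le_trans (by norm_num) (le_max_left _ _)
  have h1 : ‖u‖ ^ 2 ≤ Mx * (‖u‖ * ‖f‖) := hco.trans (by rw [← hre]; exact mul_le_mul_of_nonneg_left hcs hMx0)
  by_cases hu0 : ‖u‖ = 0
  · rw [hu0]; positivity
  · have hpos : 0 < ‖u‖ := lt_of_le_of_ne (norm_nonneg _) (Ne.symm hu0)
    nlinarith


/-! ## §2 Multiplier maps (existence as linear maps; no definition) -/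

omit [Fact (0 < c₀)] in
/-- a real site multiplier `λ ↦ w·λ` IS a `ℂ`-linear endomorphism of `SiteL2K` (conjugation of the pointwise map by `toL2S`). [cite: Balaban1985BackgroundPropagators, (3.11) p.392] -/
theorem exists_siteMul [Fact (0 < c₀)] (w : Site (F.P K) 0 → ℝ) :
    ∃ M : SiteL2K ℂ 3 (periodsT3 F K) c₀ W₂ →ₗ[ℂ] SiteL2K ℂ 3 (periodsT3 F K) c₀ W₂,
      ∀ lam : Site (F.P K) 0 → Matrix (Fin 2) (Fin 2) ℂ, M (toL2S F K c₀ lam) = toL2S F K c₀ (fun x => w x • lam x) := by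
  let L : (Site (F.P K) 0 → Matrix (Fin 2) (Fin 2) ℂ) →ₗ[ℂ] (Site (F.P K) 0 → Matrix (Fin 2) (Fin 2) ℂ) :=
    { toFun := fun l x => w x • l x
      map_add' := fun l l' => by funext x; simp only [Pi.add_apply, smul_add]
      map_smul' := fun c l => by funext x; simp only [Pi.smul_apply, RingHom.id_apply]; rw [smul_comm] }
  refine ⟨(toL2S F K c₀).toLinearMap ∘ₗ L ∘ₗ (toL2S F K c₀).symm.toLinearMap, fun lam => ?_⟩
  simp only [LinearMap.comp_apply, LinearEquiv.coe_toLinearMap, LinearEquiv.symm_apply_apply]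
  rfl

omit [Fact (0 < c₀)] in
/-- a real bond multiplier `A ↦ w·A` IS a `ℂ`-linear endomorphism of `BondL2K`. [cite: Balaban1985BackgroundPropagators, (3.11) p.392] -/
theorem exists_bondMul [Fact (0 < c₀)] (w : PBond (F.P K) 0 → ℝ) :
    ∃ M : BondL2K ℂ 3 (periodsT3 F K) c₀ W₂ →ₗ[ℂ] BondL2K ℂ 3 (periodsT3 F K) c₀ W₂,
      ∀ A : PBond (F.P K) 0 → Matrix (Fin 2) (Fin 2) ℂ, M (toL2 F K c₀ A) = toL2 F K c₀ (fun b => w b • A b) := by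
  let L : (PBond (F.P K) 0 → Matrix (Fin 2) (Fin 2) ℂ) →ₗ[ℂ] (PBond (F.P K) 0 → Matrix (Fin 2) (Fin 2) ℂ) :=
    { toFun := fun A b => w b • A b
      map_add' := fun A A' => by funext b; simp only [Pi.add_apply, smul_add]
      map_smul' := fun c A => by funext b; simp only [Pi.smul_apply, RingHom.id_apply]; rw [smul_comm] }
  refine ⟨(toL2 F K c₀).toLinearMap ∘ₗ L ∘ₗ (toL2 F K c₀).symm.toLinearMap, fun A => ?_⟩
  simp only [LinearMap.comp_apply, LinearEquiv.coe_toLinearMap, LinearEquiv.symm_apply_apply]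
  rfl

/-! ## §2b The conjugation defects, identified -/

omit [Fact (0 < c₁)] in
/-- **THE GRADIENT DEFECT**: for a positive site weight `w` with inverse `wi` (`wi·w = 1`) and any bond multiplier `Nbi` by `wi(b₋)`,
`Nbi(D_{U₀}(w·λ)) − D_{U₀}λ = toL2(b ↦ η⁻¹(w(b₊)∕w(b₋) − 1)·Ad(U₀(b))λ(b₊))` (FILE A `DL2_smul_eq_smul_add_defect`). [cite: Balaban1985BackgroundPropagators, (3.3) p.391, Thm 3.1 p.397] -/
theorem bondMulInv_DL2_siteMul_sub (w wi : Site (F.P K) 0 → ℝ) (hwi : ∀ x, wi x * w x = 1)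
    (Nbi : BondL2K ℂ 3 (periodsT3 F K) c₀ W₂ →ₗ[ℂ] BondL2K ℂ 3 (periodsT3 F K) c₀ W₂)
    (hNbi : ∀ A : PBond (F.P K) 0 → Matrix (Fin 2) (Fin 2) ℂ, Nbi (toL2 F K c₀ A) = toL2 F K c₀ (fun b => wi b.src • A b))
    (lam : Site (F.P K) 0 → Matrix (Fin 2) (Fin 2) ℂ) :
    Nbi (DL2 F n K c₀ U₀ (toL2S F K c₀ (fun x => w x • lam x))) - DL2 F n K c₀ U₀ (toL2S F K c₀ lam)
      = toL2 F K c₀ (fun b => ((eta F n K)⁻¹ * (w b.tgt / w b.src - 1)) • R (bgUnits F K U₀ b) (lam b.tgt)) := by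
  have hw0 : ∀ x, w x ≠ 0 := fun x h0 => by have := hwi x; rw [h0, mul_zero] at this; exact zero_ne_one this
  have hG : DL2 F n K c₀ U₀ (toL2S F K c₀ (fun x => w x • lam x))
      = toL2 F K c₀ (fun b => w b.src • ((toL2 F K c₀).symm (DL2 F n K c₀ U₀ (toL2S F K c₀ lam)) b + ((eta F n K)⁻¹ * (w b.tgt / w b.src - 1)) • R (bgUnits F K U₀ b) (lam b.tgt))) := by
    apply (toL2 F K c₀).symm.injective
    rw [LinearEquiv.symm_apply_apply]
    funext b
    exact DL2_smul_eq_smul_add_defect F U₀ w lam b (hw0 b.src)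
  rw [hG, hNbi]
  have hX : toL2 F K c₀ (fun b => (toL2 F K c₀).symm (DL2 F n K c₀ U₀ (toL2S F K c₀ lam)) b) = DL2 F n K c₀ U₀ (toL2S F K c₀ lam) :=
    (toL2 F K c₀).apply_symm_apply _
  rw [sub_eq_iff_eq_add', ← hX, ← map_add]
  congr 1
  funext b
  rw [smul_smul, hwi, one_smul, Pi.add_apply, LinearEquiv.symm_apply_apply]

include hseq hι in
omit [Fact (0 < c₀)] [Fact (0 < c₁)] in
/-- **THE MASS DEFECT**: for a site weight `w`, the inverse `wci` of a coarse weight and any level-`n` site multiplier `Nci` by `wci∘siteShift`,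
`Nci(ι(Q″(w·λ))) − ι(Q″λ) = ι(Q″(((wci∘B)·w − 1)·λ))` — `Q″` commutes with the block-constant `wci∘B` (FILE A `topMean_blockConst_smul`).
[cite: Balaban1985BackgroundPropagators, (3.19) p.393, (3.24) p.394] -/
theorem siteMulInv_lift_topMean_siteMul_sub (w : Site (F.P K) 0 → ℝ) (wci : Site (F.P K) (K - n) → ℝ)
    (Nci : SiteL2K ℂ 3 (periodsT3 F n) c₁ W₂ →ₗ[ℂ] SiteL2K ℂ 3 (periodsT3 F n) c₁ W₂)
    (hNci : ∀ g : Site (F.P n) 0 → Matrix (Fin 2) (Fin 2) ℂ, Nci (toL2S F n c₁ g) = toL2S F n c₁ (fun z => wci (siteShift (sites_eq F n K h) z) • g z))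
    (lam : Site (F.P K) 0 → Matrix (Fin 2) (Fin 2) ℂ) :
    Nci (ι (Q'' (toL2S F K c₀ (fun x => w x • lam x)))) - ι (Q'' (toL2S F K c₀ lam))
      = ι (Q'' (toL2S F K c₀ (fun x => (wci (iterBlockOf (K - n) x) * w x - 1) • lam x))) := by
  have h1 : Nci (ι (Q'' (toL2S F K c₀ (fun x => w x • lam x)))) = ι (Q'' (toL2S F K c₀ (fun x => (wci (iterBlockOf (K - n) x) * w x) • lam x))) := by
    rw [hι, hNci, hι]
    congr 1
    funext z
    have hb := topMean_blockConst_smul F U₀ Q'' hseq wci (fun x => w x • lam x) (siteShift (sites_eq F n K h) z)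
    have hfun : (fun x => wci (iterBlockOf (K - n) x) • (w x • lam x)) = fun x => (wci (iterBlockOf (K - n) x) * w x) • lam x := by
      funext x; rw [smul_smul]
    rw [← hb, hfun]
  have hsub : (toL2S F K c₀ fun x => (wci (iterBlockOf (K - n) x) * w x) • lam x) - toL2S F K c₀ lam
      = toL2S F K c₀ (fun x => (wci (iterBlockOf (K - n) x) * w x - 1) • lam x) := by
    rw [← map_sub]
    congr 1
    funext x
    rw [Pi.sub_apply, sub_smul, one_smul]
  rw [h1, ← map_sub, ← map_sub, hsub]

/-! ## §3 (v1.1 append) `G_a` as a linear map with its operator bound -/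

include hε₀ hε7 hreg hseq hι hT ha in
/-- ★★ **`G_a` AS A LINEAR MAP** (the chair's 22:52:45Z pin: consumers want the solution operator, not only `∃!`): there is a `ℂ`-linear `G` on `SiteL2K` with
`A(G f) = f`, `G(A u) = u` and `‖G f‖ ≤ C_P²‖f‖` for all `f, u` (`A = Δ_{U₀} + a·T(ι(Q″·))`, `C_P² = max 2 (16c₀(L^{K−n})³∕(a c₁))`) — the two-sided inverse
`LinearEquiv.ofBijective` of the injective endomorphism of §1. [cite: Balaban1985BackgroundPropagators, (3.24)–(3.25) p.394, Thm 3.11 p.416; Balaban1983RegularityDecay, (1.8) p.573] -/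
theorem exists_massive_inverse :
    ∃ G : SiteL2K ℂ 3 (periodsT3 F K) c₀ W₂ →ₗ[ℂ] SiteL2K ℂ 3 (periodsT3 F K) c₀ W₂,
      (∀ f, covLapSite F n K c₀ U₀ (G f) + (a : ℂ) • T (ι (Q'' (G f))) = f) ∧
      (∀ u, G (covLapSite F n K c₀ U₀ u + (a : ℂ) • T (ι (Q'' u))) = u) ∧
      (∀ f, ‖G f‖ ≤ max 2 (16 * c₀ * ((F.L : ℝ) ^ (K - n)) ^ 3 / (a * c₁)) * ‖f‖) := by
  set Aop : SiteL2K ℂ 3 (periodsT3 F K) c₀ W₂ →ₗ[ℂ] SiteL2K ℂ 3 (periodsT3 F K) c₀ W₂ := covLapSite F n K c₀ U₀ + (a : ℂ) • (T ∘ₗ ι ∘ₗ Q'') with hAop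
  have hA : ∀ l, Aop l = covLapSite F n K c₀ U₀ l + (a : ℂ) • T (ι (Q'' l)) := fun l => rfl
  have hinj : Function.Injective Aop := by
    have := massive_injective F h hε₀ hε7 U₀ hreg Q'' hseq ι hι T hT ha
    intro l l' hll'
    exact this (by simp only [← hA]; exact hll')
  have hsurj : Function.Surjective Aop := LinearMap.injective_iff_surjective.mp hinj
  set Ae : SiteL2K ℂ 3 (periodsT3 F K) c₀ W₂ ≃ₗ[ℂ] SiteL2K ℂ 3 (periodsT3 F K) c₀ W₂ := LinearEquiv.ofBijective Aop ⟨hinj, hsurj⟩ with hAe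
  have hAe_apply : ∀ l, Ae l = Aop l := fun l => rfl
  refine ⟨Ae.symm.toLinearMap, fun f => ?_, fun u => ?_, fun f => ?_⟩
  · show covLapSite F n K c₀ U₀ (Ae.symm f) + (a : ℂ) • T (ι (Q'' (Ae.symm f))) = f
    rw [← hA, ← hAe_apply, LinearEquiv.apply_symm_apply]
  · show Ae.symm (covLapSite F n K c₀ U₀ u + (a : ℂ) • T (ι (Q'' u))) = u
    rw [← hA, ← hAe_apply, LinearEquiv.symm_apply_apply]
  · show ‖Ae.symm f‖ ≤ _
    have hsol : covLapSite F n K c₀ U₀ (Ae.symm f) + (a : ℂ) • T (ι (Q'' (Ae.symm f))) = f := by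
      rw [← hA, ← hAe_apply, LinearEquiv.apply_symm_apply]
    exact norm_le_of_massive_eq F h hε₀ hε7 U₀ hreg Q'' hseq ι hι T hT ha _ f hsol

end Summit.QuantumFields.YangMills.Theorems.Prop7MassivePropagatorCoercive

end
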